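import Summits.Schanuel.Schanuel.Theorems.SoloBlindRoyHypothesisTorsion
import Summits.Schanuel.Schanuel.Theorems.SoloInformedRoyWindow
import Summits.Schanuel.Schanuel.Theorems.SoloInformedRoyAxisCriterion
import HarnessLib

/-!
# Roy's criterion is Schanuel at twisted points, hypothesis included (solo, informed arm)

The tree already knows (`SoloBlindRoyHypothesisTorsion`: `royHypothesis_of_forall_royConditionA`,
`royHypothesis_iff_forall_royConditionA`) that for `α ∈ (ℂˣ)^l` and admissible parameters the
rank-`l` hypothesis of Roy's Conjecture 2 holds iff every axis pair is torsion-twisted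
(`α_j^{d_j} = e^{d_j y_j}`, `d_j ≥ 1`).  Recorded here are the two consequences used in the
informed arm's atlas (§3 S2: "window (1) carries no Diophantine information beyond (a)"):

* `royHypothesis_indep_params` — the hypothesis holds for one admissible parameter set iff for
  all of them (Roy 2001, p. 184, states this for the truth of Conjecture 2; here it holds for
  its hypothesis, pointwise in `(y, α)`).
* `royCriterion_iff_forall_royConditionA` — `RoyCriterion l` is literally "`trdeg_ℚ ℚ(y, α) ≥ l`
  for `y` `ℚ`-linearly independent and `α` a coordinatewise torsion twist of `e^{y}`": no
  parameters, no auxiliary polynomials.  With `schanuelRank_iff_forall_royConditionA`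
  (`SoloInformedRoyAxisCriterion`, the same sentence for `SchanuelRank l` without the redundant
  `α_j ≠ 0`) Roy's equivalence `Roy2001_iff` is an identity of HYPOTHESES, not only of
  conclusions: Conjecture 2 and Schanuel quantify over the same points.

[cite: Roy2001, Conjecture 2, Thm. 1, §1 (p. 184), §5]
-/

noncomputable section

open MvPolynomial Filter Complex Literature.NumberTheory.Transcendental

namespace Summit.Schanuel.Schanuel.Theorems

/-- **Parameter-independence of the hypothesis.** For `α ∈ (ℂˣ)^l` the hypothesis of
Conjecture 2 holds for one admissible parameter set iff it holds for every admissible set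
(Roy 2001, p. 184: "if, for fixed `l`, Conjecture 2 is true for at least one choice of
parameters satisfying (1), then it is true for all of them" — here for the hypothesis).
[cite: Roy2001, §1 (p. 184), Thm. 1] -/
theorem royHypothesis_indep_params {l : ℕ} (y α : Fin l → ℂ) (hα : ∀ j, α j ≠ 0)
    {s₀ s₁ t₀ t₁ u s₀' s₁' t₀' t₁' u' : ℝ} (hadm : RoyAdmissible s₀ s₁ t₀ t₁ u)
    (hadm' : RoyAdmissible s₀' s₁' t₀' t₁' u') :
    RoyHypothesis y α s₀ s₁ t₀ t₁ u ↔ RoyHypothesis y α s₀' s₁' t₀' t₁' u' :=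
  (royHypothesis_iff_forall_royConditionA hα hadm).trans
    (royHypothesis_iff_forall_royConditionA hα hadm').symm

/-- Roy's parameters `(6/5, 7/10, 1, 1/2, 61/50)` are admissible. [cite: Roy2001, §1 (1)] -/
theorem royAdmissible_sixFifths : RoyAdmissible (6 / 5) (7 / 10) 1 (1 / 2) (61 / 50) :=
  royAdmissible_iff.mpr ⟨⟨by norm_num, by norm_num, by norm_num, by norm_num, by norm_num⟩,
    ⟨by norm_num, by norm_num, by norm_num, by norm_num, by norm_num, by norm_num⟩,
    ⟨by norm_num, by norm_num, by norm_num⟩⟩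

/-- **Roy's criterion is Schanuel at twisted points, hypothesis included.** `RoyCriterion l` is
equivalent to: for `y` linearly independent over `ℚ` and `α ∈ (ℂˣ)^l` with
`α_j^{d_j} = e^{d_j y_j}` (`d_j ≥ 1`) for all `j`, `trdeg_ℚ ℚ(y, α) ≥ l` — no parameters, no
auxiliary polynomials.
(`schanuelRank_iff_forall_royConditionA` says the same of `SchanuelRank l`; together they
re-prove `Roy2001_iff` as an identity of hypotheses.) [cite: Roy2001, Conjecture 2, §5] -/
theorem royCriterion_iff_forall_royConditionA (l : ℕ) :
    RoyCriterion l ↔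
      ∀ (y α : Fin l → ℂ), LinearIndependent ℚ y → (∀ j, α j ≠ 0) →
        (∀ j, RoyConditionA (y j) (α j)) →
          (l : Cardinal) ≤ Algebra.trdeg ℚ
            ↥(IntermediateField.adjoin ℚ (Set.range y ∪ Set.range α)) := by
  constructor
  · intro h y α hy hα ha
    exact h y α hy hα _ _ _ _ _ royAdmissible_sixFifths
      (royHypothesis_of_forall_royConditionA y α royAdmissible_sixFifths ha)
  · intro h y α hy hα s₀ s₁ t₀ t₁ u hadm hhyp
    exact h y α hy hα ((royHypothesis_iff_forall_royConditionA hα hadm).1 hhyp)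

end Summit.Schanuel.Schanuel.Theorems
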